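import Mathlib
import HarnessLib
import Literature.MathematicalPhysics.StatisticalMechanics.AbkmPackageSlots

/-!
# The SHRUNK package `P.shrink` — the same [ABKM19] package with the state-ball radius `r/8`

The `q`-regularity slots `F4l'` and the state slot `H1σ2` of `AbkmPackageSlots` ([ABKM19] Lemma 12.6 / Theorem 6.8
smoothness) are PROVED in the tree by the holomorphic route (Cauchy–Schwarz estimates along complex lines in the state
`(H, K)`), which needs room around the state corners INSIDE the ball on which Theorem 6.8 bounds `S_k` — the ball of radius
`P.r` whose four side conditions (`hv`, `hωA`, `hc3A`, `hc2A`) the package carries.  Corners on the boundary `‖H‖ = P.r` have no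
room.  The honest form of the slots is therefore: Theorem 6.8 on the `P.r`-ball, state corners in the `P.r/8`-ball.  This file
only provides the plumbing object for that — NOTHING is asserted:

* **`PackageData.shrink P`** — the package `P` with `r` replaced by `r/8` (every other field unchanged; the side conditions at
  `r/8` follow from those at `r` because `vABKM`, `omegaABKM`, `kappaABKM` are monotone in `r`); a `PackageAt P N M` and a
  `PackageAt P.shrink N M` are the same data (`PackageAt` does not mention `r`), and `Q.opS`, `Q.opB`, `Q.normParams` do not
  involve `r`, so `H1σ2 P.shrink Q σ₂` is literally the `H1σ2` family of `P` with the corners in the `r/8`-ball;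
* `vABKM_mono`, `omegaABKM_mono`, `kappaABKM_mono`, `kappaCond_mono` — the monotonicity facts used.

Use (honest scope): `q`- and state-regularity slots of the rung route `Summits/HubbardSuperconductivity/…/Theses/ComplexGFFStiffness`
(stiffness of a complex Gaussian gradient field via the [ABKM19] RG); nothing about superconductivity in the Hubbard model.

## References
* S. Adams, S. Buchholz, R. Kotecký, S. Müller, *Cauchy–Born rule from microscopic models with non-convex potentials*,
  arXiv:1910.13564 — Theorem 6.8 (the ball `B_ρ`), Lemma 12.6, Ch. 12 (12.4) [AdamsBuchholzKoteckyMuller2019].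
-/

noncomputable section

namespace Literature.MathematicalPhysics.StatisticalMechanics.GradientRG

open scoped BigOperators

variable {d : ℕ}

/-! ## Monotonicity of the carriers of the Theorem-6.8 ball in the radius -/

/-- `v_r = C_{8.7}·r·A_𝒫·A⁻¹` is monotone in `r` (`A_𝒫 ≥ 0`, `A > 0`).
[cite: AdamsBuchholzKoteckyMuller2019, Lemma 10.6 / Ch. 12 (12.4)] -/
theorem vABKM_mono {R : ℕ} {A A𝒫 r r' : ℝ} (hA : 0 < A) (hA𝒫 : 0 ≤ A𝒫) (hrr' : r ≤ r') :
    vABKM d R A A𝒫 r ≤ vABKM d R A A𝒫 r' := by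
  unfold vABKM
  have hC : 0 ≤ pi2BoundConst d (((2 * R + 2 : ℕ) : ℝ) + ((d / 2 + 1 : ℕ) : ℝ)) :=
    pi2BoundConst_nonneg d (by positivity)
  have hAinv : 0 ≤ A⁻¹ := inv_nonneg.2 hA.le
  exact mul_le_mul_of_nonneg_left (mul_le_mul_of_nonneg_right (mul_le_mul_of_nonneg_right hrr' hA𝒫) hAinv) hC

/-- `ω(r)` is monotone in `r`. [cite: AdamsBuchholzKoteckyMuller2019, Ch. 12 (12.4)] -/
theorem omegaABKM_mono {R : ℕ} {A A𝒫 r r' : ℝ} (hA : 0 < A) (hA𝒫 : 0 ≤ A𝒫) (hrr' : r ≤ r') :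
    omegaABKM d R A A𝒫 r ≤ omegaABKM d R A A𝒫 r' := by
  have hv := vABKM_mono (d := d) (R := R) hA hA𝒫 hrr'
  unfold omegaABKM
  have h1 : 0 ≤ 8 * Real.exp (1 / 4) := by positivity
  have h2 : 0 ≤ 16 * Real.exp (3 / 8) := by positivity
  nlinarith [h1, h2, hv, hrr']

/-- `κ(r)` is monotone in `r`. [cite: AdamsBuchholzKoteckyMuller2019, Ch. 12 (12.4)] -/
theorem kappaABKM_mono {R : ℕ} {A A𝒫 r r' : ℝ} (hA : 0 < A) (hA𝒫 : 0 ≤ A𝒫) (hrr' : r ≤ r') :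
    kappaABKM d R A A𝒫 r ≤ kappaABKM d R A A𝒫 r' := by
  have hv := vABKM_mono (d := d) (R := R) hA hA𝒫 hrr'
  unfold kappaABKM
  have h2 : 0 ≤ 16 * Real.exp (3 / 8) := by positivity
  nlinarith [h2, hv, hrr']

/-- `κ(r) ≥ 0` for `r ≥ 0`, `A > 0`, `A_𝒫 ≥ 0` (variant of `kappaABKM_nonneg` by sign data). [cite: AdamsBuchholzKoteckyMuller2019, Ch. 12 (12.4)] -/
theorem kappaABKM_nonneg_of_pos {R : ℕ} {A A𝒫 r : ℝ} (hA : 0 < A) (hA𝒫 : 0 ≤ A𝒫) (hr : 0 ≤ r) :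
    0 ≤ kappaABKM d R A A𝒫 r := by
  unfold kappaABKM vABKM
  have hC : 0 ≤ pi2BoundConst d (((2 * R + 2 : ℕ) : ℝ) + ((d / 2 + 1 : ℕ) : ℝ)) :=
    pi2BoundConst_nonneg d (by positivity)
  have hAinv : 0 ≤ A⁻¹ := inv_nonneg.2 hA.le
  positivity

/-- The large-set expressions `κ(r)^{L^d}·(2κ(r)·max(1,A_𝒫))^{n}·b^{n}` of the conditions `hc3A` / `hc2A` are monotone in
`r` (`b ≥ 0`). [cite: AdamsBuchholzKoteckyMuller2019, Ch. 12 (12.4)] -/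
theorem kappaCond_mono {R L : ℕ} {A A𝒫 r r' b : ℝ} (hA : 0 < A) (hA𝒫 : 0 ≤ A𝒫) (hr : 0 ≤ r) (hrr' : r ≤ r')
    (hb : 0 ≤ b) (n : ℕ) :
    (kappaABKM d R A A𝒫 r) ^ (L ^ d) * ((2 * (kappaABKM d R A A𝒫 r) * max 1 A𝒫) ^ n * b ^ n) ≤
      (kappaABKM d R A A𝒫 r') ^ (L ^ d) * ((2 * (kappaABKM d R A A𝒫 r') * max 1 A𝒫) ^ n * b ^ n) := by
  have hκ0 := kappaABKM_nonneg_of_pos (d := d) (R := R) hA hA𝒫 hr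
  have hκ := kappaABKM_mono (d := d) (R := R) hA hA𝒫 hrr'
  have hκ0' : 0 ≤ kappaABKM d R A A𝒫 r' := hκ0.trans hκ
  have hm : 0 ≤ max 1 A𝒫 := le_max_of_le_left zero_le_one
  gcongr

/-! ## The shrunk package -/

namespace PackageData

/-- `0 ≤ A_𝒫'` for a package (indeed `A_𝒫' = A_𝒫(θ) ≥ 1`). [cite: AdamsBuchholzKoteckyMuller2019, Thm 7.1 (w6)–(w7)] -/
theorem A𝒫'_nonneg (P : PackageData d) : 0 ≤ P.A𝒫' := by
  rw [← P.hA𝒫']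
  exact zero_le_one.trans (one_le_weightIntConstRho P.hθbar P.hθ0 P.hθ
    (traceConst_nonneg d P.Mord P.R P.hlam.le (derivSum_nonneg d P.n _)))

/-- `0 < A` for a package. [cite: AdamsBuchholzKoteckyMuller2019, Thm 6.8] -/
theorem A_pos (P : PackageData d) : 0 < P.A := lt_of_lt_of_le one_pos P.hA1

/-- Side condition `0 ≤ r/8` of the shrunk package. [cite: AdamsBuchholzKoteckyMuller2019, Theorem 6.8] -/
theorem shrink_hr0 (P : PackageData d) : 0 ≤ P.r / 8 := by linarith [P.hr0]

/-- Side condition `r/8 ≤ 1/64` of the shrunk package. [cite: AdamsBuchholzKoteckyMuller2019, Theorem 6.8] -/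
theorem shrink_hr (P : PackageData d) : P.r / 8 ≤ 1 / 64 := by linarith [P.hr0, P.hr]

/-- Side condition `v_{r/8} ≤ 1/64` of the shrunk package. [cite: AdamsBuchholzKoteckyMuller2019, Ch. 12 (12.4)] -/
theorem shrink_hv (P : PackageData d) : vABKM d P.R P.A P.A𝒫' (P.r / 8) ≤ 1 / 64 :=
  (vABKM_mono (d := d) P.A_pos P.A𝒫'_nonneg (by linarith [P.hr0])).trans P.hv

/-- Side condition `ω(r/8)A² ≤ 1` of the shrunk package. [cite: AdamsBuchholzKoteckyMuller2019, Ch. 12 (12.4)] -/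
theorem shrink_hωA (P : PackageData d) : omegaABKM d P.R P.A P.A𝒫' (P.r / 8) * P.A ^ 2 ≤ 1 :=
  (mul_le_mul_of_nonneg_right (omegaABKM_mono (d := d) P.A_pos P.A𝒫'_nonneg (by linarith [P.hr0]))
    (sq_nonneg P.A)).trans P.hωA

/-- Side condition `hc3A` at `r/8` of the shrunk package. [cite: AdamsBuchholzKoteckyMuller2019, Ch. 12 (12.4)] -/
theorem shrink_hc3A (P : PackageData d) :
    (kappaABKM d P.R P.A P.A𝒫' (P.r / 8)) ^ (P.L ^ d) * ((2 * (2 * (kappaABKM d P.R P.A P.A𝒫' (P.r / 8)) *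
      max 1 P.A𝒫')) ^ ((2 ^ (d + 1) + 2) ^ d * P.L ^ d) * (4 : ℝ) ^ ((2 ^ (d + 1) + 2) ^ d * P.L ^ d)) ≤
      P.A ^ ((1 + 1 / ((2 * (2 ^ d + 1) + 6 : ℝ) ^ d)) - 1 : ℝ) := by
  have h' := P.hc3A
  have hκ0 := kappaABKM_nonneg_of_pos (d := d) (R := P.R) P.A_pos P.A𝒫'_nonneg (shrink_hr0 P)
  have hκ := kappaABKM_mono (d := d) (R := P.R) P.A_pos P.A𝒫'_nonneg (by linarith [P.hr0] : P.r / 8 ≤ P.r)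
  have hκ0' : 0 ≤ kappaABKM d P.R P.A P.A𝒫' P.r := hκ0.trans hκ
  have hm : 0 ≤ max 1 P.A𝒫' := le_max_of_le_left zero_le_one
  refine le_trans ?_ h'
  gcongr

/-- Side condition `hc2A` at `r/8` of the shrunk package. [cite: AdamsBuchholzKoteckyMuller2019, Ch. 12 (12.4)] -/
theorem shrink_hc2A (P : PackageData d) :
    (kappaABKM d P.R P.A P.A𝒫' (P.r / 8)) ^ (P.L ^ d) * ((2 * (kappaABKM d P.R P.A P.A𝒫' (P.r / 8)) *
      max 1 P.A𝒫') ^ ((2 ^ (d + 1) + 2) ^ d * P.L ^ d) * (2 : ℝ) ^ ((2 ^ (d + 1) + 2) ^ d * P.L ^ d)) ≤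
      P.A ^ ((1 + 1 / ((2 * (2 ^ d + 1) + 6 : ℝ) ^ d)) - 1 : ℝ) :=
  (kappaCond_mono (d := d) (R := P.R) (L := P.L) P.A_pos P.A𝒫'_nonneg (shrink_hr0 P)
    (by linarith [P.hr0] : P.r / 8 ≤ P.r) (by norm_num : (0 : ℝ) ≤ 2) ((2 ^ (d + 1) + 2) ^ d * P.L ^ d)).trans P.hc2A

/-- **`P.shrink`** — the [ABKM19] package `P` with the state-ball radius `r` replaced by `r/8` and everything else
unchanged; the Theorem-6.8 side conditions at `r/8` follow from those of `P` at `r` by monotonicity.  The slots of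
`AbkmPackageSlots` evaluated at `P.shrink` are the same families with the state corners in the `r/8`-ball
(`Q.opS`, `Q.opB`, `Q.normParams`, `PackageAt` do not involve `r`). [cite: AdamsBuchholzKoteckyMuller2019, Theorem 6.8 / Ch. 12 (12.4)] -/
abbrev shrink (P : PackageData d) : PackageData d :=
  { P with
    r := P.r / 8
    hr0 := P.shrink_hr0
    hr := P.shrink_hr
    hv := P.shrink_hv
    hωA := P.shrink_hωA
    hc3A := P.shrink_hc3A
    hc2A := P.shrink_hc2A }

/-- The radius of the shrunk package is `r/8`. [cite: AdamsBuchholzKoteckyMuller2019, Theorem 6.8] -/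
@[simp] theorem shrink_r (P : PackageData d) : P.shrink.r = P.r / 8 := rfl

/-- `8 · (r/8) = r`: the shrunk radius sits eight times inside the Theorem-6.8 ball of `P`.
[cite: AdamsBuchholzKoteckyMuller2019, Theorem 6.8] -/
theorem eight_mul_shrink_r (P : PackageData d) : 8 * P.shrink.r = P.r := by
  rw [shrink_r]; ring

end PackageData

namespace PackageAt

variable {P : PackageData d} {N M : ℕ} [NeZero M]

/-- A height-`N` realisation of the shrunk package is one of the package itself (the data do not involve `r`).
[cite: AdamsBuchholzKoteckyMuller2019, Thm 6.1 / Thm 7.1] -/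
abbrev unshrink (Q : PackageAt P.shrink N M) : PackageAt P N M :=
  ⟨Q.𝒞, Q.Mc, Q.hN, Q.hM, Q.hallA, Q.hB⟩

/-- … and conversely. [cite: AdamsBuchholzKoteckyMuller2019, Thm 6.1 / Thm 7.1] -/
abbrev toShrink (Q : PackageAt P N M) : PackageAt P.shrink N M :=
  ⟨Q.𝒞, Q.Mc, Q.hN, Q.hM, Q.hallA, Q.hB⟩

/-- `S_k^{(q)}` of the shrunk realisation is `S_k^{(q)}` of the realisation (definitionally).
[cite: AdamsBuchholzKoteckyMuller2019, Thm 6.8] -/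
theorem unshrink_opS (Q : PackageAt P.shrink N M) (q : Matrix (Fin d) (Fin d) ℝ) (k : ℕ)
    (u : HamSpace ℂ d (fieldWt P.h (P.L : ℝ) d k) ((P.L : ℝ) ^ k) (P.L ^ (d * k)))
    (v : activitySpace Q.normParams k) : Q.unshrink.opS q k u v = Q.opS q k u v := rfl

end PackageAt

end Literature.MathematicalPhysics.StatisticalMechanics.GradientRG

end
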